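import Literature.NumberTheory.Automorphic.ArchLocalTorusClassExhaustion    -- ★ p839078 (B-p17 (g23)): exhaustion for ANY torus point; (V8)-sing FILES 1–2
import Literature.NumberTheory.Automorphic.ArchLocalRegularTorusClasses     -- ★ p838737 (F0P3a-p02): `circleDiagonal_mem_of_iff`, `mem_archLocal_diagonal_iff_mem_unitaryGroupOfForm`, `re_embedding_ne_zero`
import HarnessLib

/-!
# Conjugacy classes inside the stable class of a SINGULAR point of the circle torus, docked: LIST (any torus point), FINITENESS, and the count «TWO» at
# the split-singular point of `U(2,1)` in `G_w = archLocal L N (diagonal α) w` (Rogawski 1990 §3.8 Prop. 3.8.1, §8.3 p. 122)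

Topic `NumberTheory/Automorphic`; namespace `Literature.NumberTheory.Automorphic.UnitaryGroup`.  THEOREMS ONLY (no `def`, no instance, no notation, no axiom,
no `sorry`).  Cell `pub/hodgecm-mathlib`, ENGINE T1 (crux H413 = `stmt-HodgeConjecture-24833`); floor-1 preparation, count-neutral, under books rows #88 (ST-∞) ∕
#111 (S-d); author B-p17 (g23) (road D2′ gap «(V8)-sing», FILE 4 = the docking twin of F0P3a-p02's ★ `ArchLocalRegularTorusClasses` §4∕§5 for ARBITRARY
torus points).  Everything is by name over ★ `exists_perm_conj_circleDiagonal_eq_of_conj_eq` (exhaustion, (V8)-exh), ★ `ncard_conjClasses_circleDiagonal_perm_eq_two`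
((V8)-sing FILE 2) and p02's docking lemmas.

WHAT IS PROVED.
* §1 (any `U ≤ GL_N(ℂ)` that IS `U(⋆, diag e)(ℂ)` via `hU`, `e_i ≠ 0`, `z : Fin N → Circle` ARBITRARY — no `Injective z`):
  **`setOf_isConj_circleDiagonal_out_eq_range_of_conj`** — the `U`-classes meeting the `GL_N(ℂ)`-class of `diag(z)` are EXACTLY the classes of the relabelled
  torus points `diag(z ∘ ρ)`, `ρ ∈ S_N` (p02's ★ `setOf_isConj_circleDiagonal_out_eq_range` without the regularity hypothesis); `finite_setOf_isConj_circleDiagonal_out_of_conj`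
  (so the `∑ᶠ` over a stable class in ★ `stableOrbitalIntegralRel` ∕ `archStableOrbitalIntegral` is a finite sum at EVERY elliptic torus point, singular ones included);
  **`ncard_setOf_isConj_circleDiagonal_out_eq_two_of_conj`** — `N = 3`, `e` indefinite, `z` two-valued: exactly TWO classes.
* §2 (the place `w`: `G_w = archLocal L N (diagonal α) w`, `α_i ≠ 0`, `σ_w α_i` real): `conjClasses_stable_circleDiagonal_eq_range_of_conj` (any `z`),
  `finite_conjClasses_stable_circleDiagonal_of_conj` (any `z`), **`ncard_conjClasses_stable_circleDiagonal_eq_two`** — at a place of signature `(2,1)` or `(1,2)` the stable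
  class of the split-singular torus point `γ₀ = diag(a,a,b)` of the compact Cartan of `U(2,1)` consists of EXACTLY TWO conjugacy classes (vs. ★
  `ncard_conjClasses_stable_circleDiagonal_eq_three` at a regular point, ★ `…_eq_one_of_pos` at a definite place).
HONEST LABEL: HC_CM is proved only modulo the printed citations until rung 0 closes; this file is bookkeeping and pays nothing by itself.

## References
* [Rogawski1990] J. D. Rogawski, *Automorphic Representations of Unitary Groups in Three Variables*, Ann. of Math. Stud. 123 (1990): §3.1 p. 19 (stable
  conjugacy), §3.8 pp. 30–32, Prop. 3.8.1 (classes within a stable class), §4.1 (4.1.1) p. 39 (the sum over a stable class), §8.2 Prop. 8.2.1 p. 118 ∕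
  §8.3 p. 122 (the classes through regular and singular points of the compact Cartan of `U(2,1)`), §14.2 p. 232 (definite places).
* [HornJohnson2013] R. A. Horn, C. R. Johnson, *Matrix Analysis*, 2nd ed. (2013), §4.5 Thm. 4.5.8 (Sylvester's law of inertia).
-/

set_option autoImplicit false

noncomputable section

open Matrix Equiv Finset NumberField NumberField.InfinitePlace
open Literature.LinearAlgebra.Matrix Literature.NumberTheory.Rogawski1990
open scoped MatrixGroups ComplexConjugate

namespace Literature.NumberTheory.Automorphic.UnitaryGroup

/-! ## §1 The classes of ANY torus point `diag(z)` in a realisation `U` of `U(⋆, diag e)(ℂ)`: list, finiteness, the count «two» -/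

section Circle

variable (N : ℕ) (U : Subgroup (GL (Fin N) ℂ)) (e : Fin N → ℝ)

/-- **THE CLASSES INSIDE THE STABLE CLASS OF AN ARBITRARY TORUS POINT, LISTED**: in any subgroup `U ≤ GL_N(ℂ)` that IS `U(⋆, diag e)(ℂ)` (`e_i ≠ 0`), the
`U`-conjugacy classes whose members are `GL_N(ℂ)`-conjugate to the torus point `diag(z)` — `z` ARBITRARY, singular points included — are exactly the classes of
the relabelled torus points `diag(z ∘ ρ)`, `ρ ∈ S_N` (⊆ is the exhaustion theorem ★ `exists_perm_conj_circleDiagonal_eq_of_conj_eq`; ⊇ is ★ `monomial_conj_circleDiagonal`).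
[cite: Rogawski1990, §3.8 pp. 30–32 (Prop. 3.8.1); §4.1 (4.1.1) p. 39] -/
theorem setOf_isConj_circleDiagonal_out_eq_range_of_conj
    (hU : ∀ g : GL (Fin N) ℂ, g ∈ U ↔ g ∈ unitaryGroupOfForm (starRingEnd ℂ) (diagonal fun i => (e i : ℂ)))
    (he : ∀ i, e i ≠ 0) (z : Fin N → Circle) :
    {q : ConjClasses U | IsConj (circleDiagonal N z) ((Quotient.out q : U) : GL (Fin N) ℂ)} =
      Set.range fun ρ : Perm (Fin N) => ConjClasses.mk (⟨circleDiagonal N (z ∘ ρ), circleDiagonal_mem_of_iff N U hU (z ∘ ρ)⟩ : U) := by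
  obtain rfl : U = unitaryGroupOfForm (starRingEnd ℂ) (diagonal fun i => (e i : ℂ)) := Subgroup.ext hU
  ext q
  rw [Set.mem_setOf_eq, Set.mem_range]
  constructor
  · intro hq
    obtain ⟨g, hg⟩ := isConj_iff.mp hq
    obtain ⟨ρ, u, hu⟩ := exists_perm_conj_circleDiagonal_eq_of_conj_eq N he z (Quotient.out q).2 g hg
    refine ⟨ρ.symm, ?_⟩
    have hmk : ConjClasses.mk (⟨circleDiagonal N (fun i => z (ρ.symm i)), circleDiagonal_mem_unitaryGroupOfForm_diagonal N _ _⟩ :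
          unitaryGroupOfForm (starRingEnd ℂ) (diagonal fun i => (e i : ℂ))) = ConjClasses.mk (Quotient.out q) :=
      ConjClasses.mk_eq_mk_iff_isConj.mpr (isConj_iff.mpr ⟨u, Subtype.ext (by
        rw [Subgroup.coe_mul, Subgroup.coe_mul, Subgroup.coe_inv]; exact hu)⟩)
    exact hmk.trans (Quotient.out_eq q)
  · rintro ⟨ρ, rfl⟩
    have h1 : IsConj (⟨circleDiagonal N (z ∘ ρ), circleDiagonal_mem_of_iff N _ hU (z ∘ ρ)⟩ :
          unitaryGroupOfForm (starRingEnd ℂ) (diagonal fun i => (e i : ℂ)))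
        (Quotient.out (ConjClasses.mk (⟨circleDiagonal N (z ∘ ρ), circleDiagonal_mem_of_iff N _ hU (z ∘ ρ)⟩ :
          unitaryGroupOfForm (starRingEnd ℂ) (diagonal fun i => (e i : ℂ))))) :=
      ConjClasses.mk_eq_mk_iff_isConj.mp (Quotient.out_eq _).symm
    have h2 : IsConj (circleDiagonal N z) (circleDiagonal N (z ∘ ρ)) := by
      refine isConj_iff.mpr ⟨Matrix.GeneralLinearGroup.mkOfDetNeZero _ (det_monomial_one_ne_zero N ρ.symm), ?_⟩
      have h3 := monomial_conj_circleDiagonal N ρ.symm z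
      simp only [Equiv.symm_symm] at h3
      exact h3
    exact h2.trans ((unitaryGroupOfForm (starRingEnd ℂ) (diagonal fun i => (e i : ℂ))).subtype.map_isConj h1)

/-- **FINITELY MANY CLASSES IN THE STABLE CLASS OF ANY TORUS POINT** — at most `N!`; so the `∑ᶠ` over the stable class in ★ `stableOrbitalIntegralRel` ∕
`archStableOrbitalIntegral` is a finite sum at every elliptic torus point, singular ones included. [cite: Rogawski1990, §4.1 (4.1.1) p. 39; §3.8 pp. 30–32 (Prop. 3.8.1)] -/
theorem finite_setOf_isConj_circleDiagonal_out_of_conj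
    (hU : ∀ g : GL (Fin N) ℂ, g ∈ U ↔ g ∈ unitaryGroupOfForm (starRingEnd ℂ) (diagonal fun i => (e i : ℂ)))
    (he : ∀ i, e i ≠ 0) (z : Fin N → Circle) :
    {q : ConjClasses U | IsConj (circleDiagonal N z) ((Quotient.out q : U) : GL (Fin N) ℂ)}.Finite := by
  rw [setOf_isConj_circleDiagonal_out_eq_range_of_conj N U e hU he z]
  exact Set.finite_range _

/-- **EXACTLY TWO CLASSES AT THE SPLIT-SINGULAR POINT** (`N = 3`): in any realisation `U` of an INDEFINITE `U(⋆, diag e)(ℂ) ≅ U(2,1)` (`e_i ≠ 0`), the stable class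
of a torus point `diag(z)` with exactly two eigenvalues (singular slot `k`: `z j = z k ↔ j = k`, `z` constant off `k` — the point `γ₀ = diag(a,a,b)`) meets EXACTLY TWO
`U`-classes (★ `ncard_conjClasses_circleDiagonal_perm_eq_two` + the list above). [cite: Rogawski1990, §8.3 p. 122 (§8.2 Prop. 8.2.1 p. 118); §3.8 pp. 30–32 (Prop. 3.8.1)]
[cite: HornJohnson2013, §4.5 Thm 4.5.8 (Sylvester)] -/
theorem ncard_setOf_isConj_circleDiagonal_out_eq_two_of_conj (U : Subgroup (GL (Fin 3) ℂ)) {e : Fin 3 → ℝ}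
    (hU : ∀ g : GL (Fin 3) ℂ, g ∈ U ↔ g ∈ unitaryGroupOfForm (starRingEnd ℂ) (diagonal fun i => (e i : ℂ)))
    (he : ∀ i, e i ≠ 0) (hind : ∃ i j, 0 < e i ∧ e j < 0) {z : Fin 3 → Circle} {k : Fin 3} (hk : ∀ j, z j = z k ↔ j = k)
    (hzz : ∀ i j, i ≠ k → j ≠ k → z i = z j) :
    {q : ConjClasses U | IsConj (circleDiagonal 3 z) ((Quotient.out q : U) : GL (Fin 3) ℂ)}.ncard = 2 := by
  rw [setOf_isConj_circleDiagonal_out_eq_range_of_conj 3 U e hU he z]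
  obtain rfl : U = unitaryGroupOfForm (starRingEnd ℂ) (diagonal fun i => (e i : ℂ)) := Subgroup.ext hU
  have hset : (Set.range fun ρ : Perm (Fin 3) =>
      ConjClasses.mk (⟨circleDiagonal 3 (z ∘ ρ), circleDiagonal_mem_of_iff 3 _ hU (z ∘ ρ)⟩ :
        unitaryGroupOfForm (starRingEnd ℂ) (diagonal fun i => (e i : ℂ)))) =
      {q | ∃ ρ : Perm (Fin 3), q = ConjClasses.mk ⟨circleDiagonal 3 (fun i => z (ρ.symm i)),
          circleDiagonal_mem_unitaryGroupOfForm_diagonal 3 _ _⟩} := by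
    ext q
    simp only [Set.mem_range, Set.mem_setOf_eq]
    constructor
    · rintro ⟨ρ, rfl⟩
      exact ⟨ρ.symm, by simp only [Equiv.symm_symm]; rfl⟩
    · rintro ⟨ρ, rfl⟩
      exact ⟨ρ.symm, rfl⟩
  rw [hset]
  exact ncard_conjClasses_circleDiagonal_perm_eq_two he hind hk hzz

end Circle

/-! ## §2 Docking into `G_w = U(σ_w diag α)(ℂ) = archLocal L N (diagonal α) w` -/

section Place

variable (L : Type) [Field L] (N : ℕ) (α : Fin N → L) (w : {w : InfinitePlace L // IsComplex w})

/-- **THE CLASSES IN THE STABLE CLASS OF ANY TORUS POINT OF `G_w`, LISTED** — exactly the classes of `diag(z ∘ ρ)`, `ρ ∈ S_N`, for EVERY `z` (p02's ★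
`conjClasses_stable_circleDiagonal_eq_range` without regularity); the index set of the `∑ᶠ` in ★ `stableOrbitalIntegralRel (IsStablyConj ⋆ (σ_w H′))` at `γ = diag(z)`.
[cite: Rogawski1990, §3.8 pp. 30–32 (Prop. 3.8.1); §4.1 (4.1.1) p. 39] -/
theorem conjClasses_stable_circleDiagonal_eq_range_of_conj (hα : ∀ i, α i ≠ 0) (hreal : ∀ i, (w.1.embedding (α i)).im = 0)
    (z : Fin N → Circle) :
    {q : ConjClasses (archLocal L N (diagonal α) w) | IsStablyConj (starRingEnd ℂ) ((diagonal α).map w.1.embedding)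
        (⟨circleDiagonal N z, circleDiagonal_mem_archLocal_diagonal L N α w z⟩ : archLocal L N (diagonal α) w) (Quotient.out q)} =
      Set.range fun ρ : Perm (Fin N) =>
        ConjClasses.mk (⟨circleDiagonal N (z ∘ ρ), circleDiagonal_mem_archLocal_diagonal L N α w (z ∘ ρ)⟩ : archLocal L N (diagonal α) w) :=
  setOf_isConj_circleDiagonal_out_eq_range_of_conj N (archLocal L N (diagonal α) w) (fun i => (w.1.embedding (α i)).re)
    (mem_archLocal_diagonal_iff_mem_unitaryGroupOfForm L N α w hreal) (re_embedding_ne_zero L N α w hα hreal) z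

/-- The same set is FINITE, for every torus point `diag(z)` of `G_w`. [cite: Rogawski1990, §4.1 (4.1.1) p. 39] -/
theorem finite_conjClasses_stable_circleDiagonal_of_conj (hα : ∀ i, α i ≠ 0) (hreal : ∀ i, (w.1.embedding (α i)).im = 0)
    (z : Fin N → Circle) :
    {q : ConjClasses (archLocal L N (diagonal α) w) | IsStablyConj (starRingEnd ℂ) ((diagonal α).map w.1.embedding)
        (⟨circleDiagonal N z, circleDiagonal_mem_archLocal_diagonal L N α w z⟩ : archLocal L N (diagonal α) w) (Quotient.out q)}.Finite := by
  rw [conjClasses_stable_circleDiagonal_eq_range_of_conj L N α w hα hreal z]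
  exact Set.finite_range _

/-- **«TWO CLASSES» THROUGH THE SPLIT-SINGULAR POINT OF THE COMPACT CARTAN OF `U(2,1)` AT `w`**: for `N = 3`, a place `w` where the real weights
`re σ_w(α_i)` take BOTH signs (signature `(2,1)` or `(1,2)`), and a torus point `diag(z)` with exactly two eigenvalues (`z = (a,a,b)` in some order, singular slot
`k`), the stable class of `diag(z)` in `G_w` consists of EXACTLY TWO conjugacy classes — against THREE through a regular point (★
`ncard_conjClasses_stable_circleDiagonal_eq_three`) and ONE at a definite place. [cite: Rogawski1990, §8.3 p. 122 (§8.2 Prop. 8.2.1 p. 118); §3.8 pp. 30–32 (Prop. 3.8.1)] -/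
theorem ncard_conjClasses_stable_circleDiagonal_eq_two {α : Fin 3 → L} (hα : ∀ i, α i ≠ 0) (hreal : ∀ i, (w.1.embedding (α i)).im = 0)
    (hind : ∃ i j, 0 < (w.1.embedding (α i)).re ∧ (w.1.embedding (α j)).re < 0) {z : Fin 3 → Circle} {k : Fin 3}
    (hk : ∀ j, z j = z k ↔ j = k) (hzz : ∀ i j, i ≠ k → j ≠ k → z i = z j) :
    {q : ConjClasses (archLocal L 3 (diagonal α) w) | IsStablyConj (starRingEnd ℂ) ((diagonal α).map w.1.embedding)
        (⟨circleDiagonal 3 z, circleDiagonal_mem_archLocal_diagonal L 3 α w z⟩ : archLocal L 3 (diagonal α) w) (Quotient.out q)}.ncard = 2 :=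
  ncard_setOf_isConj_circleDiagonal_out_eq_two_of_conj (archLocal L 3 (diagonal α) w)
    (mem_archLocal_diagonal_iff_mem_unitaryGroupOfForm L 3 α w hreal) (re_embedding_ne_zero L 3 α w hα hreal) hind hk hzz

end Place

end Literature.NumberTheory.Automorphic.UnitaryGroup
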